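import Summits.BirchSwinnertonDyer.BirchSwinnertonDyer.Theorems.SemiOrdinaryEisensteinDescentShaTwoCochainLayerNaturality
import Literature.NumberTheory.GaloisRepresentations.IdeleClassBarInvariant
import HarnessLib

/-!
# The Ш²-cochain bridge, step S3b (class side): the global invariant `inv_{E/K}(iso_E w) = classInvAll K E (iso_E w)` of a layer class
# `w ∈ H²(Γ_K ⧸ U_E, C̄^{U_E})` of the idèle class module depends only on its CONTINUOUS inflation `infTwo (toAbsLayer w) ∈ H²_cont(Γ_K, C̄)`
# (Tate, C–F VII §11.2, diagram (4) and (bis): `inv_{E'/K} ∘ Inf = inv_{E/K}`; Serre CG I §2.2 Prop. 8)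

Route `SemiOrdinaryEisensteinDescent` (BSD, rung W-ALL row 2·3@3), Kolyvagin column, Cassels–Tate lane (print item
`CasselsTateLevelInputsFact`, stmt-BirchSwinnertonDyer-20191).  Sequel of `…ShaTwoCochainIdeleDescent` (p640146),
`…ShaTwoCochainIdeleInvariantSum` (p641863) and `…ShaTwoCochainLayerNaturality` (p642812); this file is lemma (T-Cα) of the memo
`Cruxes/WildKolyvaginUpperAtThree/S3-IDELE-DESCENT-w2g11.md` §3 — the C̄-side of step S3 of w3 g7's SHA2-BRIDGE memo §1 (vi): it lets the
S4 assembler identify the two numbers `classInvAll K E (ideleToClass K E [b])` (idèle side: `exists_galLayer_localInvariants` +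
`IdeleCohomology.classInvAll_ideleToClass`) and road B's `classInvAll K E' (iso_{E'} ((h^{U_{E'}})_* (δ c)))`
(`IdeleClassBar.classBarInv_inflG_comp_boundary_eq_classInvAll`) as soon as both layer classes inflate to the same continuous class
`[j ∘ Z] ∈ H²_cont(Γ_K, C̄)` (`ShaTwoCochain.idele_class_of_bridgeCocycle`, p634550).

* §1 `mapCocycles₂_toAbsLayerHom_apply_coe` (values), **`toAbsLayer_two_injective`** — door-c6's transport
  `toAbsLayer E X 2 : H²(Γ_K ⧸ U_E, X^{U_E}) → H²(Γ_K ⧸ Γ_E, (toDGM X)^{Γ_E})` is injective (on cocycles: a coboundary of the transported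
  cocycles transports back; Mathlib `H2π_eq_iff`).  Generic `X : C_Γ`.
* §2 **`layerInv_eq_of_infTwo_toAbsLayer_eq`**, **`classInvAll_eq_of_infTwo_toAbsLayer_eq`** — (T-Cα):
  `infTwo_eq_infTwo_iff_exists_layerInf_eq` (door-c6 g10) → `layerInf_toAbsLayer` (p642812) → §1 → `IdeleClassBar.layerInv_stepG` (door-c4).

THEOREMS ONLY (no definition, no instance, no instance attribute, no named fact, no `sorry`); one `set_option maxHeartbeats` on §1's
injectivity proof (the layer-module rewrites are slow, exactly as in door-c4 g18's degree-one `ExtOneDescent.transport_mem_cocycles₁`).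
Bookkeeping; no case of BSD, of Poitou–Tate or of Cassels–Tate is proved; BSD is not proved by any of this.
Width seat `bsd-wall-soed-p2-w2` g11; `--supports stmt-BirchSwinnertonDyer-20480`, helper.  Route-free.

## References
* [CasselsFrohlichANT1967] J. W. S. Cassels, A. Fröhlich (eds.), *Algebraic Number Theory* (1967), Ch. VII (J. Tate) §11.2 (diagram (4), (bis)).
* [SerreGaloisCohomology1997] J.-P. Serre, *Galois Cohomology* (1997), I §2.2 Proposition 8.
-/
noncomputable section

set_option linter.dupNamespace false
set_option autoImplicit false

namespace Summit.BirchSwinnertonDyer.BirchSwinnertonDyer.Theorems.ShaTwoCochain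

open CategoryTheory groupCohomology Field NumberField IsDedekindDomain
open Literature.NumberTheory.GaloisRepresentations Literature.NumberTheory.GaloisRepresentations.IdeleClassBar
open Literature.NumberTheory.GaloisRepresentations.DGMBridge Literature.NumberTheory.GaloisRepresentations.LayerDelta
open Literature.Algebra.Homology Literature.Algebra.Homology.DiscreteRep
open scoped ContRepresentation

variable {K : Type} [Field K] [NumberField K]

/-! ## §1 `toAbsLayer` is injective in degree two -/

omit [NumberField K] in
/-- Values of door-c6's transport on cocycles: `(toAbsLayer-cocycle of b)([σ], [τ]) = b([σ], [τ])` (identity of vectors).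
[cite: SerreGaloisCohomology1997, I §2.2 Proposition 8] -/
theorem mapCocycles₂_toAbsLayerHom_apply_coe (E : GalLayer K) [Normal K E.1] (X : DiscreteRepCat ℤ (absoluteGaloisGroup K))
    (b : cocycles₂ ((invariantsQuotFunctor ℤ (E.openNormalSubgroup : Subgroup (absoluteGaloisGroup K))).obj X))
    (σ τ : absoluteGaloisGroup K) :
    LCarrier.val X ((mapCocycles₂ (quotEquivAbs E).toMonoidHom (toAbsLayerHom E X) b)
        ((σ : absoluteGaloisGroup K ⧸ absGaloisFixingSubgroup E.1), (τ : absoluteGaloisGroup K ⧸ absGaloisFixingSubgroup E.1))).1 =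
      (b (QuotientGroup.mk σ, QuotientGroup.mk τ)).1 := by
  rw [coe_mapCocycles₂, HomDual.cochainsMap₂_apply]
  rfl

omit [NumberField K] in
-- (as in door-c4 g18's degree-one `ExtOneDescent.transport_mem_cocycles₁`: the rewrites in the layer-module currency are slow)
set_option maxHeartbeats 1600000 in
/-- **`toAbsLayer E X 2` is injective** (`H²(Γ_K ⧸ U_E, X^{U_E}) → H²(Γ_K ⧸ Γ_E, (toDGM X)^{Γ_E})`): if the transported cocycles
differ by the coboundary of a `1`-cochain `a` of `Γ_K ⧸ Γ_E`, the original ones differ by the coboundary of the transported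
cochain `q ↦ a((quotEquivAbs E)⁻¹ q)` (identity of vectors; Mathlib `H2π_eq_iff`).  Generic `X : C_Γ`.
[cite: SerreGaloisCohomology1997, I §2.2 Proposition 8] -/
theorem toAbsLayer_two_injective (E : GalLayer K) [Normal K E.1] (X : DiscreteRepCat ℤ (absoluteGaloisGroup K)) :
    Function.Injective (toAbsLayer E X 2) := by
  intro x₁ x₂ h
  induction x₁ using H2_induction_on with
  | h b₁ =>
  induction x₂ using H2_induction_on with
  | h b₂ =>
  rw [toAbsLayer_H2π, toAbsLayer_H2π, H2π_eq_iff] at h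
  obtain ⟨a, ha⟩ := h
  rw [H2π_eq_iff]
  -- the transported `1`-cochain `q ↦ a (quotEquivAbs⁻¹ q)` of `Γ_K ⧸ U_E` with values in `X^{U_E}` (identity of vectors)
  refine ⟨fun q => ⟨LCarrier.val X (a ((quotEquivAbs E).symm q)).1, fun n =>
    congrArg (LCarrier.val X) ((a ((quotEquivAbs E).symm q)).2 ⟨n.1, mem_absGaloisFixingSubgroup_of_mem E n.2⟩)⟩, ?_⟩
  funext gh
  obtain ⟨g, h'⟩ := gh
  induction g using QuotientGroup.induction_on with
  | H σ =>
  induction h' using QuotientGroup.induction_on with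
  | H τ =>
  -- evaluate `ha` at `([σ], [τ])` in the `Γ_E`-currency and read it in `X`
  have hστ := congrArg (fun f : (absoluteGaloisGroup K ⧸ absGaloisFixingSubgroup E.1) ×
      (absoluteGaloisGroup K ⧸ absGaloisFixingSubgroup E.1) → (absGaloisLayerRep K E.1 (toDGM X)).V =>
      LCarrier.val X (f ((σ : absoluteGaloisGroup K ⧸ absGaloisFixingSubgroup E.1),
        (τ : absoluteGaloisGroup K ⧸ absGaloisFixingSubgroup E.1))).1) ha
  simp only [d₁₂_hom_apply, Pi.sub_apply, Submodule.coe_sub, Submodule.coe_add, map_sub, map_add] at hστ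
  apply Subtype.ext
  simp only [d₁₂_hom_apply, Pi.sub_apply]
  rw [← QuotientGroup.mk_mul] at hστ ⊢
  simp only [quotEquivAbs_symm_mk]
  exact hστ

/-! ## §2 `classInvAll` of a layer class of `C̄` depends only on its continuous inflation -/

/-- **(T-C) The global invariant is a function of the continuous class.**  For layers `E₁, E₂` and classes
`wᵢ ∈ H²(Γ_K ⧸ U_{Eᵢ}, C̄^{U_{Eᵢ}})` whose inflations to `H²_cont(Γ_K, C̄)` (`infTwo ∘ toAbsLayer`) coincide, the layer invariants agree:
`layerInv E₁ w₁ = layerInv E₂ w₂`, i.e. `inv_{E₁/K}(iso_{E₁} w₁) = inv_{E₂/K}(iso_{E₂} w₂)`.  (The continuous classes agree iff the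
`Γ_E`-layer classes agree in a common bigger layer; there the transitions are door-c4's under `toAbsLayer` (`layerInf_toAbsLayer`),
`toAbsLayer` is injective (`toAbsLayer_two_injective`), and `inv_{E'/K} ∘ Inf = inv_{E/K}` (`IdeleClassBar.layerInv_stepG`).)
[cite: CasselsFrohlichANT1967, Ch. VII §11.2 (diagram (4)) and (bis)][cite: SerreGaloisCohomology1997, I §2.2 Proposition 8] -/
theorem layerInv_eq_of_infTwo_toAbsLayer_eq (E₁ E₂ : GalLayer K) [Normal K E₁.1] [Normal K E₂.1]
    [FiniteDimensional K E₁.1] [FiniteDimensional K E₂.1]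
    (w₁ : groupCohomology (IdeleClassBar.layerRep E₁) 2) (w₂ : groupCohomology (IdeleClassBar.layerRep E₂) 2)
    (h : infTwo K E₁.1 (toDGM (classBarD K)) (toAbsLayer E₁ (classBarD K) 2 w₁) =
      infTwo K E₂.1 (toDGM (classBarD K)) (toAbsLayer E₂ (classBarD K) 2 w₂)) :
    layerInv E₁ w₁ = layerInv E₂ w₂ := by
  obtain ⟨E', hfd, hn, h₁, h₂, hEq⟩ :=
    (infTwo_eq_infTwo_iff_exists_layerInf_eq K E₁.1 (toDGM (classBarD K)) E₂.1 _ _).1 h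
  haveI := hfd
  haveI := hn
  haveI : IsGalois K E' := IsGalois.mk
  let E'' : GalLayer K := ⟨E', hfd, inferInstance⟩
  have h₁' : E₁ ≤ E'' := h₁
  have h₂' : E₂ ≤ E'' := h₂
  haveI : Normal K E''.1 := hn
  haveI : FiniteDimensional K E''.1 := hfd
  -- in the common layer, door-c4's transitions of `w₁`, `w₂` have the same `toAbsLayer`-image, hence coincide
  have n₁ := layerInf_toAbsLayer E₁ E'' h₁' (classBarD K) 2 w₁
  have n₂ := layerInf_toAbsLayer E₂ E'' h₂' (classBarD K) 2 w₂
  have hstep := toAbsLayer_two_injective E'' (classBarD K) (n₁.symm.trans (hEq.trans n₂))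
  rw [← layerInv_stepG h₁' w₁, ← layerInv_stepG h₂' w₂]
  exact congrArg (layerInv E'') hstep

/-- **(T-C) in the cell's `inv_{E/K} = classInvAll`**: under the same hypothesis,
`classInvAll K E₁ (iso_{E₁} w₁) = classInvAll K E₂ (iso_{E₂} w₂)` (door-c5's `IdeleClassBar.layerCohomologyIso`).
[cite: CasselsFrohlichANT1967, Ch. VII §11.2 (bis)] -/
theorem classInvAll_eq_of_infTwo_toAbsLayer_eq (E₁ E₂ : GalLayer K) [Normal K E₁.1] [Normal K E₂.1]
    [FiniteDimensional K E₁.1] [FiniteDimensional K E₂.1]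
    (w₁ : groupCohomology (IdeleClassBar.layerRep E₁) 2) (w₂ : groupCohomology (IdeleClassBar.layerRep E₂) 2)
    (h : infTwo K E₁.1 (toDGM (classBarD K)) (toAbsLayer E₁ (classBarD K) 2 w₁) =
      infTwo K E₂.1 (toDGM (classBarD K)) (toAbsLayer E₂ (classBarD K) 2 w₂)) :
    (haveI := E₁.numberField; haveI := E₁.isGalois;
      IdeleCohomology.classInvAll K E₁.1 ((IdeleClassBar.layerCohomologyIso E₁ 2).hom w₁)) =
      (haveI := E₂.numberField; haveI := E₂.isGalois;
        IdeleCohomology.classInvAll K E₂.1 ((IdeleClassBar.layerCohomologyIso E₂ 2).hom w₂)) := by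
  rw [← layerInv_apply, ← layerInv_apply]
  exact layerInv_eq_of_infTwo_toAbsLayer_eq E₁ E₂ w₁ w₂ h

end Summit.BirchSwinnertonDyer.BirchSwinnertonDyer.Theorems.ShaTwoCochain

end
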